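import Mathlib
import HarnessLib
import Summits.HubbardSuperconductivity.HubbardSuperconductivity.Theorems.KLProgrammeC4aPPKernelFamilyRows

/-!
# Route `KLProgramme` — crux C4a, S3 brick (B4) «(B4)-UMK1», «(M1)-FAMILY» part 6: THE ONE-CALL BUNDLE `ppFamilyKernel_rows`

Cell `gate-hubbard-kl`, seat hubbard-kl-k3c3-p1 (g16; row «δμ-flow with klAngularMean constant piece»), pen rulings (R319)(E)/(R321)(B) (owner split: k3c3-p3 the
primed laws, k3c3-p1 the kernel bundle).  For the physical kernel family `Kr := ppFamilyKernel β Λ κ lo · · / C` (true particle–particle kernel × finer-line split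
floored at the scale, normalised), **`ppFamilyKernel_rows`** returns the conjunction of the thirteen kernel rows of k3c3-p3's primed fold-box law
`…FoldBoxLawRowsPrimed.foldBox_law_rows'` (p-landed 03:52Z) — and of its capstone `nearCausticBox_integral_le'` — in that law's binder order and shapes, at
`qs := (1−t₁)/t₁`, `Dfl := hi/t₁`, `ρm := ρᶠ/C`, `Mρ := Mρᶠ/C`, `Afl`, `Bfl` explicit; `familyRow_qs_ge` (part 5: `3/2 ≤ qs`) and **`ppFamilyKernel_consts_nonneg`**
(`0 ≤ Afl, Bfl, Mρ`) serve the law's `hqs/hAfl/hBfl/hMρ` rows; the law's remaining threshold is `hDfl : K₁·Δ ≤ hi/t₁`.  Each conjunct is the corresponding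
`familyRow_*` of part 5.  Memo HOME/hubbard-kl-k3c3-p1/g16-M1-NEG-PRE-KERNEL.md §7–§8.
Pure real analysis on Literature objects; nothing asserts (C), K3, the window or superconductivity.
References: BGM 2006 §2.4 (2.36) [cite: BenfattoGiulianiMastropietro2006]; FST II CPAM 51 (1998) §3 [cite: FeldmanSalmhoferTrubowitz1998].
-/

noncomputable section

namespace Summit.HubbardSuperconductivity.HubbardSuperconductivity.Theorems.C4a

set_option linter.dupNamespace false -- summit = problem name (single-conjunct summit), D-0017

open Real Filter Set MeasureTheory intervalIntegral
open scoped Topology Interval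
open Literature.MathematicalPhysics.QuantumLattice Literature.Analysis.SpecialFunctions

section Bundle

variable {β Λ : ℝ} (hβ : 0 < β) (hΛ : 0 < Λ) {B₁ B₂ : ℝ} (hB₁ : ∀ x, |deriv salmhoferCutoff x| ≤ B₁) (hB₂ : ∀ x, |deriv (deriv salmhoferCutoff) x| ≤ B₂)
  {κ κ' κ'' : ℝ → ℝ} (hκ : ∀ t, HasDerivAt κ (κ' t) t) (hκ' : ∀ t, HasDerivAt κ' (κ'' t) t) (hκ''c : Continuous κ'')
  {κ₀ κ₁ κ₂ : ℝ} (hκb : ∀ t ∈ Icc 0 1, |κ t| ≤ κ₀) (hκ'b : ∀ t ∈ Icc 0 1, |κ' t| ≤ κ₁) (hκ''b : ∀ t ∈ Icc 0 1, |κ'' t| ≤ κ₂)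
  {t₁ : ℝ} (ht₀ : 0 < t₁) (ht25 : t₁ ≤ 2 / 5) (hκs : ∀ t, t₁ ≤ t → κ t = 0) (hκ's : ∀ t, t₁ ≤ t → κ' t = 0) (hκ''s : ∀ t, t₁ ≤ t → κ'' t = 0)
  {lo hi C : ℝ} (hlo : 0 < lo) (hloΛ : lo ≤ Λ) (hC : 0 < C)

include hβ hΛ hB₁ hB₂ hκ hκ' hκ''c hκb hκ'b hκ''b ht₀ ht25 hκs hκ's hκ''s hlo hloΛ hC in
/-- **THE ONE-CALL BUNDLE `ppFamilyKernel_rows`** (pen (R319)(E)/(R321)(B); consumer: k3c3-p3's primed laws `…FoldBoxLawRowsPrimed.foldBox_law_rows'` /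
`nearCausticBox_integral_le'` and the (C)-closer c4a-1): for `Kr(e,u) := ppFamilyKernel β Λ κ lo e u / C` with `C` above the four envelope constants, the
THIRTEEN kernel rows `hKd, hK2d, hK0, hK1, hK2, hsupp, hKc, hflat, hKn1, hρ0, hρc, hρtail, hKs1` of `foldBox_law_rows'` IN ITS BINDER ORDER AND SHAPES, with
`qs := (1−t₁)/t₁` (`≥ 3/2`, `familyRow_qs_ge`), `Dfl := hi/t₁`, `ρm := ρᶠ/C`, `Mρ := Mρᶠ/C`, `Afl := W(A₁Λ/lo + C₁(1−t₁)⁻²)/C`, `Bfl := W′C₁t₁²(1−t₁)⁻²/C`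
written out; the weight rows are taken in the law's own shapes (`wt` continuous and `0 ≤ wt ≤ W` on `[−hi,hi]`) plus the Lipschitz row
`|wt e − wt lo| ≤ W′(e − lo)` on `[lo,hi]` (`W′ ≥ 0`).  Use: `obtain ⟨hKd, hK2d, hK0, hK1, hK2, hsupp, hKc, hflat, hKn1, hρ0, hρc, hρtail, hKs1⟩ :=
ppFamilyKernel_rows …`.  [cite: BenfattoGiulianiMastropietro2006, §2.4 (2.36)] [cite: FeldmanSalmhoferTrubowitz1998, §3] -/
theorem ppFamilyKernel_rows (hC0 : κ₀ * (12 * B₁ + 9) ≤ C)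
    (hC1 : κ₀ * (64 * B₂ + 96 * B₁ + 136 + (12 * B₁ + 9) / min 1 ((1 - t₁) / t₁)) + κ₁ * (12 * B₁ + 9) ≤ C)
    (hC2 : (κ₀ * ((16 * B₂ + 24 * B₁ + 33) / (1 - t₁) ^ 2) + 2 * (κ₀ + κ₁) * ((6 * B₁ + 5 / 2) / (1 - t₁)) + (2 * κ₀ + 4 * κ₁ + κ₂)) +
        (3 * κ₀ * (16 * B₂ + 24 * B₁ + 33) + 2 * (6 * B₁ + 9 / 2) * (3 * κ₁ + 9 * κ₀) + (3 * κ₂ + 24 * κ₁ + 54 * κ₀)) ≤ C)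
    (hCs : κ₀ * (128 * B₁ + 72) + 8 * κ₁ ≤ C) (hlohi : lo ≤ hi) {wt : ℝ → ℝ} {W W' : ℝ} (hwc : ContinuousOn wt (Icc (-hi) hi))
    (hw0 : ∀ e ∈ Icc (-hi) hi, 0 ≤ wt e) (hwW : ∀ e ∈ Icc (-hi) hi, wt e ≤ W) (hW' : 0 ≤ W') (hwL : ∀ e ∈ Icc lo hi, |wt e - wt lo| ≤ W' * (e - lo)) :
    (∀ e ∈ Icc (-hi) hi, e ≠ 0 → ContDiff ℝ 1 (fun v : ℝ => ppFamilyKernel β Λ κ lo e v / C)) ∧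
    (∀ e ∈ Icc lo hi, ContDiff ℝ 2 (fun v : ℝ => ppFamilyKernel β Λ κ lo e v / C)) ∧
    (∀ e ∈ Icc (-hi) hi, e ≠ 0 → ∀ u, |ppFamilyKernel β Λ κ lo e u / C| ≤ (max |e| |u|)⁻¹) ∧
    (∀ e ∈ Icc (-hi) hi, e ≠ 0 → ∀ u, |deriv (fun v : ℝ => ppFamilyKernel β Λ κ lo e v / C) u| ≤ (max |e| |u|)⁻¹ ^ 2) ∧
    (∀ e ∈ Icc lo hi, ∀ u, |iteratedDeriv 2 (fun v : ℝ => ppFamilyKernel β Λ κ lo e v / C) u| ≤ (max e |u|)⁻¹ ^ 3) ∧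
    (∀ e ∈ Icc lo hi, ∀ u, |u| ≤ (1 - t₁) / t₁ * e → deriv (fun v : ℝ => ppFamilyKernel β Λ κ lo e v / C) u = 0) ∧
    (Continuous fun p : ℝ × ℝ => deriv (fun v : ℝ => ppFamilyKernel β Λ κ lo p.1 v / C) p.2) ∧
    (∀ D : ℝ, 0 < D → D ≤ hi / t₁ → |∫ e in lo..hi, wt e * deriv (fun v : ℝ => ppFamilyKernel β Λ κ lo e v / C) (D - e)| ≤
      W * (((6 * B₁ + 5 / 2) * (2 * κ₀ + κ₁) * (4 / (1 - t₁) ^ 2) + κ₀ * (10 * B₁ + 7 / 2 + 2 / (β * Λ) + 1 / (1 - t₁))) * (Λ / lo) +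
            (κ₀ * ((6 * B₁ + 5 / 2) / (1 - t₁)) + κ₀ + κ₁) / (1 - t₁) ^ 2) / C * (lo / (max D lo) ^ 2) +
        W' * (κ₀ * ((6 * B₁ + 5 / 2) / (1 - t₁)) + κ₀ + κ₁) * t₁ ^ 2 / (1 - t₁) ^ 2 / C) ∧
    (∀ s ∈ Icc lo hi, ∀ u, s / 2 ≤ u → |deriv (fun v : ℝ => ppFamilyKernel β Λ κ lo (-s) v / C) u| ≤
      (64 * (κ₀ * (64 * B₂ + 120 * B₁ + 154) + κ₁ * (12 * B₁ + 9)) * Λ ^ 3 / (s + 2 * Λ) ^ 3 +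
          (κ₀ * ((β * lo) ^ 2 + 2) + κ₁ * (β * lo + 1)) * Real.exp (-(β / 2 * s))) / C * ((max (u - s) lo)⁻¹ ^ 2)) ∧
    (∀ s ∈ Icc lo hi, 0 ≤ (64 * (κ₀ * (64 * B₂ + 120 * B₁ + 154) + κ₁ * (12 * B₁ + 9)) * Λ ^ 3 / (s + 2 * Λ) ^ 3 +
          (κ₀ * ((β * lo) ^ 2 + 2) + κ₁ * (β * lo + 1)) * Real.exp (-(β / 2 * s))) / C) ∧
    (ContinuousOn (fun s : ℝ => (64 * (κ₀ * (64 * B₂ + 120 * B₁ + 154) + κ₁ * (12 * B₁ + 9)) * Λ ^ 3 / (s + 2 * Λ) ^ 3 +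
          (κ₀ * ((β * lo) ^ 2 + 2) + κ₁ * (β * lo + 1)) * Real.exp (-(β / 2 * s))) / C) (Icc lo hi)) ∧
    (∀ a ∈ Icc lo hi, ∫ s in a..hi, (64 * (κ₀ * (64 * B₂ + 120 * B₁ + 154) + κ₁ * (12 * B₁ + 9)) * Λ ^ 3 / (s + 2 * Λ) ^ 3 +
          (κ₀ * ((β * lo) ^ 2 + 2) + κ₁ * (β * lo + 1)) * Real.exp (-(β / 2 * s))) / C ≤
      (32 * (κ₀ * (64 * B₂ + 120 * B₁ + 154) + κ₁ * (12 * B₁ + 9)) * (Λ / lo) ^ 3 +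
          32 * (κ₀ * ((β * lo) ^ 2 + 2) + κ₁ * (β * lo + 1)) / (β * lo) ^ 3) / C * (lo * (lo / a) ^ 2)) ∧
    (∀ e ∈ Icc (-lo) lo, ∀ u, |deriv (fun v : ℝ => ppFamilyKernel β Λ κ lo e v / C) u| ≤ (max lo |u|)⁻¹ ^ 2) := by
  have hB10 : 0 ≤ B₁ := salmhoferB₁_nonneg hB₁
  have hB20 : 0 ≤ B₂ := salmhoferB₂_nonneg hB₂
  have hκ₀ : 0 ≤ κ₀ := (abs_nonneg _).trans (hκb 0 (left_mem_Icc.2 zero_le_one))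
  have hκ₁ : 0 ≤ κ₁ := (abs_nonneg _).trans (hκ'b 0 (left_mem_Icc.2 zero_le_one))
  have hκ'c : Continuous κ' := continuous_iff_continuousAt.2 fun t => (hκ' t).continuousAt
  have hsub : Icc lo hi ⊆ Icc (-hi) hi := Icc_subset_Icc (by linarith only [hlo, hlohi]) le_rfl
  have hwc' : ContinuousOn wt (Icc lo hi) := hwc.mono hsub
  have hwW' : ∀ e ∈ Icc lo hi, |wt e| ≤ W := fun e he => by
    rw [abs_of_nonneg (hw0 e (hsub he))]; exact hwW e (hsub he)
  exact ⟨familyRow_hKd hβ hΛ hB₁ hκ hκ' ht25 hκs hlo,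
    familyRow_hK2d hβ hΛ hB₁ hB₂ hκ hκ' hκ''c ht₀ ht25 hκs hκ's hκ''s hlo,
    familyRow_hK0 hβ hΛ hB₁ hκb hlo hC hC0,
    familyRow_hK1 hβ hΛ hB₁ hB₂ hκ hκb hκ'b ht₀ ht25 hκs hlo hC hC1,
    familyRow_hK2 hβ hΛ hB₁ hB₂ hκ hκ' hκb hκ'b hκ''b ht₀ ht25 hκs hκ's hκ''s hlo hC hC2,
    familyRow_hsupp hβ hΛ hB₁ hκ ht₀ ht25 hκs hκ's hlo,
    familyRow_hKc hβ hΛ hB₁ hκ ht25 hκs hκ's hlo hκ'c,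
    fun D hD hDhi => familyRow_hflat hβ hΛ hB₁ hκ hκb hκ'b ht₀ ht25 hκs hκ's hlo hloΛ hC hκ'c hlohi hwc' hwW' hW' hwL hD hDhi,
    familyRow_hKn1 hβ hΛ hB₁ hB₂ hκ hκb hκ'b ht25 hκs hlo hC,
    familyRow_hρ0 hβ hΛ hC hB10 hB20 hκ₀ hκ₁ hlo,
    familyRow_hρc (β := β) (B₁ := B₁) (B₂ := B₂) (κ₀ := κ₀) (κ₁ := κ₁) (C := C) hΛ hlo,
    familyRow_hρtail hβ hΛ hC hB10 hB20 hκ₀ hκ₁ hlo,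
    familyRow_hKs1 hβ hΛ hB₁ hκ hκb hκ'b ht25 hκs hlo hloΛ hC hCs⟩

include hβ hΛ hB₁ hB₂ hκb hκ'b ht25 hlo hC in
/-- The bundle's constants are nonnegative: `0 ≤ Afl`, `0 ≤ Bfl`, `0 ≤ Mρ` (the law's `hAfl`, `hBfl`, `hMρ` rows), for `0 ≤ W`, `0 ≤ W′`. [folklore] -/
theorem ppFamilyKernel_consts_nonneg {W W' : ℝ} (hW : 0 ≤ W) (hW' : 0 ≤ W') :
    0 ≤ W * (((6 * B₁ + 5 / 2) * (2 * κ₀ + κ₁) * (4 / (1 - t₁) ^ 2) + κ₀ * (10 * B₁ + 7 / 2 + 2 / (β * Λ) + 1 / (1 - t₁))) * (Λ / lo) +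
            (κ₀ * ((6 * B₁ + 5 / 2) / (1 - t₁)) + κ₀ + κ₁) / (1 - t₁) ^ 2) / C ∧
    0 ≤ W' * (κ₀ * ((6 * B₁ + 5 / 2) / (1 - t₁)) + κ₀ + κ₁) * t₁ ^ 2 / (1 - t₁) ^ 2 / C ∧
    0 ≤ (32 * (κ₀ * (64 * B₂ + 120 * B₁ + 154) + κ₁ * (12 * B₁ + 9)) * (Λ / lo) ^ 3 +
          32 * (κ₀ * ((β * lo) ^ 2 + 2) + κ₁ * (β * lo + 1)) / (β * lo) ^ 3) / C := by
  have hB10 : 0 ≤ B₁ := salmhoferB₁_nonneg hB₁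
  have hB20 : 0 ≤ B₂ := salmhoferB₂_nonneg hB₂
  have hκ₀ : 0 ≤ κ₀ := (abs_nonneg _).trans (hκb 0 (left_mem_Icc.2 zero_le_one))
  have hκ₁ : 0 ≤ κ₁ := (abs_nonneg _).trans (hκ'b 0 (left_mem_Icc.2 zero_le_one))
  obtain ⟨s, hs, hs0⟩ : ∃ s : ℝ, s = 1 - t₁ ∧ 0 < s := ⟨1 - t₁, rfl, by linarith only [ht25]⟩
  rw [← hs]
  exact ⟨by positivity, by positivity, by positivity⟩

end Bundle

end Summit.HubbardSuperconductivity.HubbardSuperconductivity.Theorems.C4a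

end
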